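import Literature.AlgebraicGeometry.GroupSchemes.BarsottiTateGroupFormallySmooth
import Literature.AlgebraicGeometry.Deformation.MorphismLiftsSquareZeroSmoothAffine
import Mathlib.AlgebraicGeometry.Morphisms.Etale
import HarnessLib

/-!
# Infinitesimal lifting for SMOOTH AFFINE morphisms over any base; ÉTALE Barsotti–Tate groups are formally smooth (unconditionally)

Topic `Literature/AlgebraicGeometry/GroupSchemes`; namespace `Literature.AlgebraicGeometry.GroupSchemes` (+ `BTGroup`).  THEOREMS ONLY (no
definition, no named fact, no instance, no notation, no `sorry`).  Cell `hodgecm-mathlib` (D-0151 ∕ D-0183 FLOOR 0), P6 «MOD programme», sequel of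
organ (G5) ★ `BarsottiTateGroupFormallySmooth` (p844635: the predicates `BTGroup.LiftsAlong` ∕ `BTGroup.IsFormallySmooth` and the NAMED FACT
`Messing1972_isFormallySmooth_of_isNilpotent` = [Messing1972] II (3.3.13)).  This file PROVES the case of (3.3.13) that needs no passage up the
inductive system: Barsotti–Tate groups with SMOOTH (for finite flat layers: ÉTALE) layers are formally smooth over ANY base — a non-vacuity
∕ sanity anchor for the predicate and the input for ind-étale `p`-divisible groups (étale quotients `G^ét`, the `(0,2)`-signature factors of
MOD-PLAN L4B.4 «the BT group is étale … and deforms uniquely»).  `--supports stmt-HodgeConjecture-24832`; COUNT-NEUTRAL: HC_CM is proved only modulo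
the printed citations until rung 0 closes; nothing here is about HC.

THE PRINT.  [EGAIV4] Déf. (17.1.1) (formally smooth: lifting of `S`-morphisms `Spec (A⧸J) → Z` to `Spec A → Z` for affine test schemes and nilpotent
`J`), Prop. (17.1.6) ∕ (17.3.1) (smooth ⇒ formally smooth); [SGA1] Exp. III §5 Cor. 5.2 (local extensions into a smooth target exist); [Messing1972]
Ch. II Thm. (3.3.13) (Barsotti–Tate groups over a `p`-nilpotent base are formally smooth — here the étale sub-case, where `p` plays no role).

* §1 **`exists_lift_of_smooth_of_isAffineHom`** — `q : Z → S` smooth and affine (e.g. finite étale), `J ⊆ A` nilpotent, `a : Spec A → S`,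
  `z₀ : Spec (A⧸J) → Z` over `a` ⇒ `∃ z : Spec A → Z` over `a` with `z ∣ Spec (A⧸J) = z₀`.  Proof: base change to `Spec A` (Mathlib
  `MorphismProperty.pullback_snd`, `isAffine_of_isAffineHom`), then ★ `Deformation.exists_lift_of_smooth_affine` (A-p08∕A-p03 road: chart of the
  point + Mathlib `Algebra.FormallySmooth.liftOfSurjective`) on the affine open `⊤` along `A ↠ A⧸J`, and project back with `pullback.fst`.
* §2 **`BTGroup.liftsAlong_of_smooth`**, **`BTGroup.isFormallySmooth_of_smooth`**, **`BTGroup.isFormallySmooth_of_etale`** — for ★ `BTGroup S p h`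
  with `Smooth (B.hom n)` (resp. `Etale (B.hom n)`) for all `n`: `B.IsFormallySmooth`, lifting inside the same layer (`transition (le_refl n) = 𝟙`).

NOT HERE: the general case of (3.3.13) (named fact ★ `Messing1972_isFormallySmooth_of_isNilpotent`); uniqueness of lifts for étale layers ([SGA1] I 5.5,
★ `RingTheory/Etale/LiftNilpotentThickeningHom`).

## References
* [EGAIV4] A. Grothendieck, J. Dieudonné, *Éléments de géométrie algébrique* IV₄, Publ. Math. IHÉS 32 (1967) — Déf. (17.1.1), Prop. (17.1.6).
* [SGA1] A. Grothendieck, M. Raynaud, *Revêtements étales et groupe fondamental*, LNM 224 — Exp. III §5 Cor. 5.2.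
* [Messing1972] W. Messing, *The Crystals Associated to Barsotti–Tate Groups*, LNM 264 (1972) — Ch. II Thm. (3.3.13).
-/

noncomputable section

universe u

open CategoryTheory CategoryTheory.Limits AlgebraicGeometry

namespace Literature.AlgebraicGeometry.GroupSchemes

/-! ## §1 Points of a smooth affine `S`-scheme lift along nilpotent thickenings of affine test schemes -/

/-- **Infinitesimal lifting for a SMOOTH, AFFINE morphism `q : Z → S` over ANY base** ([EGAIV4] Prop. (17.1.6) ∕ Déf. (17.1.1): smooth ⇒
formally smooth; [SGA1] III Cor. 5.2): for a ring `A`, a NILPOTENT ideal `J`, `a : Spec A → S` and a point `z₀ : Spec (A⧸J) → Z` over `a`,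
there is `z : Spec A → Z` over `a` restricting to `z₀`.  Proof: base-change `q` to `Spec A` (smooth and affine are stable under base
change; `Z ×_S Spec A` is then an affine scheme) and apply ★ `Deformation.exists_lift_of_smooth_affine` on the affine open `⊤` to the point
`(z₀, Spec (A⧸J) → Spec A)` of the fibre product, along the surjection `A → A⧸J`. [cite: EGAIV4, Déf. (17.1.1) and Prop. (17.1.6)]
[cite: SGA1, Exp. III §5 Cor. 5.2] -/
theorem exists_lift_of_smooth_of_isAffineHom {Z S : Scheme.{u}} (q : Z ⟶ S) [Smooth q] [IsAffineHom q]
    {A : Type u} [CommRing A] (J : Ideal A) (hJ : IsNilpotent J) (a : Spec (.of A) ⟶ S)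
    (z₀ : Spec (.of (A ⧸ J)) ⟶ Z) (hz₀ : z₀ ≫ q = Spec.map (CommRingCat.ofHom (Ideal.Quotient.mk J)) ≫ a) :
    ∃ z : Spec (.of A) ⟶ Z, z ≫ q = a ∧ Spec.map (CommRingCat.ofHom (Ideal.Quotient.mk J)) ≫ z = z₀ := by
  -- base change to `Spec A`
  let p : pullback q a ⟶ Spec (.of A) := pullback.snd q a
  haveI : IsAffineHom p := MorphismProperty.pullback_snd _ _ ‹_›
  haveI : IsAffine (pullback q a) := isAffine_of_isAffineHom p
  -- the point of the fibre product
  let f₀ : Spec (.of (A ⧸ J)) ⟶ pullback q a :=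
    pullback.lift z₀ (Spec.map (CommRingCat.ofHom (Ideal.Quotient.mk J))) hz₀
  have hπ : Function.Surjective (Ideal.Quotient.mkₐ A J) := Ideal.Quotient.mkₐ_surjective A J
  have hker : IsNilpotent (RingHom.ker (Ideal.Quotient.mkₐ A J : A →+* A ⧸ J)) := by
    rwa [Ideal.Quotient.mkₐ_ker]
  have w₀ : f₀ ≫ p = Spec.map (CommRingCat.ofHom (algebraMap A (A ⧸ J))) := pullback.lift_snd _ _ _
  have hf₀ : f₀ ⁻¹ᵁ (⊤ : (pullback q a).Opens) = ⊤ := rfl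
  obtain ⟨g, -, hg, hg₀⟩ :=
    Deformation.exists_lift_of_smooth_affine p (Ideal.Quotient.mkₐ A J) (isAffineOpen_top _) hπ hker f₀ w₀ hf₀
  refine ⟨g ≫ pullback.fst q a, ?_, ?_⟩
  · rw [Category.assoc, pullback.condition, ← Category.assoc, hg, Algebra.algebraMap_self, CommRingCat.ofHom_id,
      Spec.map_id, Category.id_comp]
  · have hπ' : (Ideal.Quotient.mkₐ A J : A →+* A ⧸ J) = Ideal.Quotient.mk J := rfl
    rw [← hπ', ← Category.assoc, hg₀, pullback.lift_fst]

namespace BTGroup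

variable {S : Scheme.{u}} {p h : ℕ}

/-! ## §2 Barsotti–Tate groups with smooth (= étale) layers are formally smooth — the étale case of [Messing1972] II (3.3.13), PROVED -/

/-- **A Barsotti–Tate group whose layers `G n → S` are SMOOTH (for finite flat layers: ÉTALE) lifts along every nilpotent thickening
`Spec (A⧸J) ↪ Spec A` over every `a : Spec A → S`** — inside the SAME layer (`m = n`, transition `𝟙`): the layers are finite, hence
affine morphisms, and smooth, so `exists_lift_of_smooth_of_isAffineHom` applies.  The étale case of [Messing1972] Ch. II Thm. (3.3.13),
unconditionally (no hypothesis on `p`). [cite: Messing1972, Ch. II Thm. (3.3.13)] [cite: EGAIV4, Déf. (17.1.1) and Prop. (17.1.6)] -/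
theorem liftsAlong_of_smooth (B : BTGroup S p h) (hB : ∀ n, Smooth (B.hom n)) {A : Type u} [CommRing A] (J : Ideal A)
    (hJ : IsNilpotent J) (a : Spec (.of A) ⟶ S) : B.LiftsAlong J a := by
  intro n x₀ hx₀
  haveI := hB n
  haveI := B.isFinite n
  obtain ⟨x, hx, hx'⟩ := exists_lift_of_smooth_of_isAffineHom (B.hom n) J hJ a x₀ hx₀
  exact ⟨n, le_rfl, x, hx, by rw [hx', transition_self, Over.id_left, Category.comp_id]⟩

/-- **ÉTALE-LAYER BARSOTTI–TATE GROUPS ARE FORMALLY SMOOTH** (smooth layers suffice): `B.IsFormallySmooth` — the case of [Messing1972] II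
(3.3.13) in which no passage up the inductive system is needed (e.g. `ℚ_p⧸ℤ_p`-type ∕ ind-étale groups, the étale quotient `G^ét` over a
base where it exists). [cite: Messing1972, Ch. II Thm. (3.3.13)] [cite: EGAIV4, Déf. (17.1.1) and Prop. (17.1.6)] -/
theorem isFormallySmooth_of_smooth (B : BTGroup S p h) (hB : ∀ n, Smooth (B.hom n)) : B.IsFormallySmooth :=
  fun _ _ J hJ a => B.liftsAlong_of_smooth hB J hJ a

/-- The same with ÉTALE layers (Mathlib `Etale ⇒ Smooth`). [cite: Messing1972, Ch. II Thm. (3.3.13)] [cite: EGAIV4, Déf. (17.1.1) and Prop. (17.1.6)] -/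
theorem isFormallySmooth_of_etale (B : BTGroup S p h) (hB : ∀ n, Etale (B.hom n)) : B.IsFormallySmooth :=
  B.isFormallySmooth_of_smooth fun n => by haveI := hB n; infer_instance

end BTGroup

end Literature.AlgebraicGeometry.GroupSchemes

end
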